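import Mathlib.MeasureTheory.Function.LpSpace.Complete
import Mathlib.MeasureTheory.Function.ConvergenceInMeasure
import Mathlib.MeasureTheory.Constructions.Polish.StronglyMeasurable
import Mathlib.MeasureTheory.Function.Floor
import Mathlib.Topology.UniformSpace.HeineCantor
import HarnessLib

/-!
# Jointly measurable versions of continuous `L^p`-valued maps on a time interval

Support file (measure theory) of the discharge programme for
`Literature.Analysis.FluidPDE.fujita_kato_local` (dictionary step, plan in
`Literature/Analysis/FluidPDE/FujitaKatoLocal.lean`): a mild solution built on the Fourier side
is, at each time, only an `L²` *class* `f(t) ∈ L²(ℝ³)`, while the tree's duality-form predicate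
`IsMildNSSolutionOn` and the measurability clause of `fujita_kato_local` speak of an honest
function `u : ℝ → ℝ³ → ℝ³`, jointly measurable on `(0,T) × ℝ³`, whose every time slice must be
the right class (the duality identity is required at *every* `t`). This file proves the
selection theorem that bridges the two (`exists_measurable_uncurry_of_continuousOn_Lp`):

**Theorem.** Let `f : ℝ → L^p(μ; E)` (`1 ≤ p`, `E` a second-countable Banach space) be
continuous on `[0, T]`. Then there is `g : ℝ → α → E` with `uncurry g` measurable and
`g t = f t` almost everywhere for **every** `t ∈ [0, T]`.

Proof: by uniform continuity on the compact interval choose grids of mesh `δ_k` on which `f`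
oscillates by less than `2^{-k}`; the step maps `F_k(t) = f(δ_k ⌊t/δ_k⌋)` are jointly measurable
(countably many slices), and `‖F_k(t) − f(t)‖_p < 2^{-k}` for every `t`. The summable rate makes
`(F_k(t, x))_k` converge for a.e. `x` at every `t` (`MeasureTheory.ae_tendsto_of_cauchy_eLpNorm`,
the Borel–Cantelli step of the Riesz–Fischer theorem); the pointwise `limUnder` is jointly
measurable (`MeasureTheory.StronglyMeasurable.limUnder`) and agrees a.e. with `f(t)` because a
subsequence converges a.e. to `f(t)` (`TendstoInMeasure.exists_seq_tendsto_ae`). This is the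
standard argument that a measurable (here continuous) `L^p`-valued map has a jointly measurable
representative (cf. the proof of the Riesz–Fischer theorem, Rudin, *Real and Complex Analysis*,
Thm. 3.11, and Doob's separable-modification technique).

## Mathlib search

Mathlib has the ingredients (`ae_tendsto_of_cauchy_eLpNorm`, `tendstoInMeasure_of_tendsto_eLpNorm`,
`TendstoInMeasure.exists_seq_tendsto_ae`, `StronglyMeasurable.limUnder`,
`measurable_from_prod_countable_left`, `Nat.measurable_floor`,
`IsCompact.uniformContinuousOn_of_continuous`) but no statement producing a jointly measurable
representative of an `L^p`-valued path (searched `uncurry`, `jointly`, `StronglyMeasurable.*Lp`).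

## References

* W. Rudin, *Real and Complex Analysis*, 3rd ed., McGraw–Hill 1987, Thm. 3.11 (Riesz–Fischer:
  a Cauchy sequence in `L^p` with summable increments converges a.e.).
-/

noncomputable section

open MeasureTheory Set Function Filter Topology
open scoped ENNReal NNReal

namespace Literature.Analysis.FunctionSpaces

variable {α : Type*} [MeasurableSpace α] {μ : Measure α}
  {E : Type*} [NormedAddCommGroup E] [SecondCountableTopology E] [CompleteSpace E]
  [MeasurableSpace E] [BorelSpace E]
  {p : ℝ≥0∞} [hp : Fact (1 ≤ p)]

/-- The geometric bound `∑ 2 · 2^{-N} = 4 ≠ ∞` used as the Cauchy modulus. [folklore] -/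
theorem tsum_two_mul_half_pow_ne_top : ∑' N : ℕ, (2 : ℝ≥0∞) * 2⁻¹ ^ N ≠ ∞ := by
  rw [ENNReal.tsum_mul_left, ENNReal.tsum_geometric, ENNReal.one_sub_inv_two, inv_inv]
  norm_num

/-- `ofReal ((1/2)^k) = (1/2)^k` in `ℝ≥0∞`. [folklore] -/
theorem ofReal_half_pow (k : ℕ) : ENNReal.ofReal ((2 : ℝ)⁻¹ ^ k) = 2⁻¹ ^ k := by
  rw [ENNReal.ofReal_pow (by norm_num), ENNReal.ofReal_inv_of_pos two_pos, ENNReal.ofReal_ofNat]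

/-- **A jointly measurable version of a continuous `L^p`-valued path.** If `f : ℝ → L^p(μ; E)`
is continuous on `[0, T]` (`1 ≤ p`, `E` a second-countable Banach space), there is
`g : ℝ → α → E` with `uncurry g` measurable and `g t = f t` a.e. for *every* `t ∈ [0, T]`
(grid step functions, the summable-increment a.e. convergence of the Riesz–Fischer theorem,
and the measurability of pointwise limits; Rudin, *Real and Complex Analysis*, Thm. 3.11). [cite: Rudin1987, Thm. 3.11] -/
theorem exists_measurable_uncurry_of_continuousOn_Lp {T : ℝ} (f : ℝ → Lp E p μ)
    (hf : ContinuousOn f (Icc 0 T)) :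
    ∃ g : ℝ → α → E, Measurable (uncurry g) ∧ ∀ t ∈ Icc 0 T, g t =ᵐ[μ] f t := by
  classical
  have hp1 : 1 ≤ p := hp.out
  have hp0 : p ≠ 0 := (zero_lt_one.trans_le hp1).ne'
  -- uniform continuity with tolerance `2^{-k}`
  have hU := Metric.uniformContinuousOn_iff.1 (isCompact_Icc.uniformContinuousOn_of_continuous hf)
  have hδ : ∀ k : ℕ, ∃ δ > 0, ∀ x ∈ Icc 0 T, ∀ y ∈ Icc 0 T, dist x y < δ →
      dist (f x) (f y) < (2 : ℝ)⁻¹ ^ k := fun k => hU _ (by positivity)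
  choose δ hδpos hδf using hδ
  -- the grids
  set π : ℕ → ℝ → ℝ := fun k t => δ k * (⌊t / δ k⌋₊ : ℝ) with hπ
  have hπ_mem : ∀ k, ∀ t ∈ Icc 0 T, π k t ∈ Icc 0 T ∧ dist (π k t) t < δ k := by
    intro k t ht
    have h1 : (⌊t / δ k⌋₊ : ℝ) ≤ t / δ k := Nat.floor_le (div_nonneg ht.1 (hδpos k).le)
    have h2 : t / δ k < ⌊t / δ k⌋₊ + 1 := Nat.lt_floor_add_one _
    have h3 : π k t ≤ t := by
      calc δ k * (⌊t / δ k⌋₊ : ℝ) ≤ δ k * (t / δ k) := mul_le_mul_of_nonneg_left h1 (hδpos k).le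
        _ = t := mul_div_cancel₀ _ (hδpos k).ne'
    have h4 : t - π k t < δ k := by
      have := mul_lt_mul_of_pos_left h2 (hδpos k)
      rw [mul_div_cancel₀ _ (hδpos k).ne', mul_add, mul_one] at this
      simp only [hπ]
      linarith
    refine ⟨⟨mul_nonneg (hδpos k).le (Nat.cast_nonneg _), h3.trans ht.2⟩, ?_⟩
    rw [Real.dist_eq, abs_sub_comm, abs_of_nonneg (sub_nonneg.2 h3)]
    exact h4
  -- the step approximations
  set F : ℕ → ℝ → α → E := fun k t => ⇑(f (π k t)) with hF
  have hF_meas : ∀ k, Measurable (uncurry (F k)) := by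
    intro k
    have hH : Measurable fun q : α × ℕ => (f (δ k * (q.2 : ℝ)) : α → E) q.1 :=
      measurable_from_prod_countable_left (f := fun q : α × ℕ => (f (δ k * (q.2 : ℝ)) : α → E) q.1)
        fun n => by
          change Measurable fun x : α => (f (δ k * (n : ℝ)) : α → E) x
          exact (Lp.stronglyMeasurable _).measurable
    have hfl : Measurable fun t : ℝ => ⌊t / δ k⌋₊ := Nat.measurable_floor.comp (measurable_id.div_const _)
    exact hH.comp (measurable_snd.prodMk (hfl.comp measurable_fst))
  have hF_dist : ∀ k, ∀ t ∈ Icc 0 T, eLpNorm (F k t - ⇑(f t)) p μ < 2⁻¹ ^ k := by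
    intro k t ht
    obtain ⟨hmem, hd⟩ := hπ_mem k t ht
    rw [hF, ← Lp.edist_def, edist_dist, ← ofReal_half_pow]
    exact (ENNReal.ofReal_lt_ofReal_iff (by positivity)).2 (hδf k _ hmem _ ht hd)
  -- the Cauchy modulus and a.e. convergence at each time
  have hcau : ∀ t ∈ Icc 0 T, ∀ N n m : ℕ, N ≤ n → N ≤ m →
      eLpNorm (F n t - F m t) p μ < 2 * 2⁻¹ ^ N := by
    intro t ht N n m hn hm
    have hsplit : F n t - F m t = (F n t - ⇑(f t)) + (⇑(f t) - F m t) := by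
      simp only [sub_add_sub_cancel]
    have h2 : (2⁻¹ : ℝ≥0∞) ≤ 1 := by norm_num
    calc eLpNorm (F n t - F m t) p μ
        ≤ eLpNorm (F n t - ⇑(f t)) p μ + eLpNorm (⇑(f t) - F m t) p μ := by
          rw [hsplit]
          exact eLpNorm_add_le ((Lp.aestronglyMeasurable _).sub (Lp.aestronglyMeasurable _))
            ((Lp.aestronglyMeasurable _).sub (Lp.aestronglyMeasurable _)) hp1
      _ < 2⁻¹ ^ n + 2⁻¹ ^ m := by
          refine ENNReal.add_lt_add (hF_dist n t ht) ?_
          rw [eLpNorm_sub_comm]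
          exact hF_dist m t ht
      _ ≤ 2⁻¹ ^ N + 2⁻¹ ^ N :=
          add_le_add (pow_le_pow_right_of_le_one' h2 hn) (pow_le_pow_right_of_le_one' h2 hm)
      _ = 2 * 2⁻¹ ^ N := (two_mul _).symm
  have hae : ∀ t ∈ Icc 0 T, ∀ᵐ x ∂μ, ∃ l : E, Tendsto (fun k => F k t x) atTop (𝓝 l) :=
    fun t ht => Lp.ae_tendsto_of_cauchy_eLpNorm (fun k => Lp.aestronglyMeasurable _) hp1
      tsum_two_mul_half_pow_ne_top (hcau t ht)
  -- the pointwise limit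
  refine ⟨fun t x => limUnder atTop fun k => F k t x, ?_, fun t ht => ?_⟩
  · exact (MeasureTheory.StronglyMeasurable.limUnder (l := atTop) (f := fun k => uncurry (F k))
      fun k => (hF_meas k).stronglyMeasurable).measurable
  · have hconv : Tendsto (fun k => eLpNorm (F k t - ⇑(f t)) p μ) atTop (𝓝 0) := by
      have h0 : Tendsto (fun k : ℕ => (2⁻¹ : ℝ≥0∞) ^ k) atTop (𝓝 0) :=
        ENNReal.tendsto_pow_atTop_nhds_zero_iff.2 (ENNReal.inv_lt_one.2 (by norm_num))
      exact tendsto_of_tendsto_of_tendsto_of_le_of_le tendsto_const_nhds h0 (fun k => zero_le)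
        fun k => (hF_dist k t ht).le
    have hmeas := tendstoInMeasure_of_tendsto_eLpNorm hp0
      (fun k => (Lp.aestronglyMeasurable _ : AEStronglyMeasurable (F k t) μ))
      (Lp.aestronglyMeasurable (f t)) hconv
    obtain ⟨ns, hns, hlim⟩ := hmeas.exists_seq_tendsto_ae
    filter_upwards [hae t ht, hlim] with x hx1 hx2
    have hfull : Tendsto (fun k => F k t x) atTop (𝓝 (limUnder atTop fun k => F k t x)) :=
      tendsto_nhds_limUnder hx1
    exact tendsto_nhds_unique (hfull.comp hns.tendsto_atTop) hx2

end Literature.Analysis.FunctionSpaces
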